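import Summits.CriticalPhenomena.Ising3DConformalLimit.Theses.FKParityRobustness
import Summits.CriticalPhenomena.Ising3DConformalLimit.Theorems.FKParityRobustnessStrandShadowComposition
import Summits.CriticalPhenomena.Ising3DConformalLimit.Theorems.FKParityRobustnessStrandShadowPairSplit
import Summits.CriticalPhenomena.Ising3DConformalLimit.Theorems.StrandShadow.Negative.PairSplitDeletion
import Summits.CriticalPhenomena.Ising3DConformalLimit.Theorems.FKParityRobustnessDepletionBound
import Summits.CriticalPhenomena.Ising3DConformalLimit.Theorems.FKParityRobustnessStrandShadowFootprintFloor
import Summits.CriticalPhenomena.Ising3DConformalLimit.Theorems.FKParityRobustnessStrandShadowThreeClean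
import Summits.CriticalPhenomena.Ising3DConformalLimit.Theorems.FKParityRobustnessStrandShadowSymmetry
import Summits.CriticalPhenomena.Ising3DConformalLimit.Theorems.FKParityRobustnessStrandsJoinBound
import Summits.CriticalPhenomena.Ising3DConformalLimit.Theorems.FKParityRobustnessDefs
import Literature.Probability.LatticeModels.GKSInequalities
import Literature.Probability.LatticeModels.ModifiedSimonInequality
import Literature.Probability.LatticeModels.IsingThermodynamics
import Literature.Probability.LatticeModels.CriticalTwoPointLower
import Literature.Probability.LatticeModels.ThermodynamicLimit
import Literature.Combinatorics.SimpleGraph.CycleSpaceSeparators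
import HarnessLib

/-!
# Line `loop-footprint-strand-mass` for the crux `StrandShadow` (stmt-CriticalPhenomena-14626)
# — crux-plan skeleton (planner, round 1)

`StrandShadow_proof : StrandShadow := StrandShadow_of stub_footprintFloor stub_thermalOverlapFloor
  stub_overlapCeiling stub_junkMargin`, sorries ONLY in the four `stub_*` theorems.

Architecture (card `Ideas/loop-footprint-strand-mass.md`, triage `TRIAGE-r1-1/2.md`, frame of
`Disproof.lean` §1–§4: formal crux = `C′ + J`, `C′ ⟺ INT`):

* `stub_footprintFloor` (finite graph, PROVABLE NOW, M; the card's lever (E)+(F) stated edgewise as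
  the triage asked): for the sourced loop-O(1) measure `ℓ^{xy}_{G,t}`, `0 ≤ t < 1`, and every edge
  `e`, `P^{xy}[e ∈ E(K_x(F))] ≥ ℓ^{xy}[e ∈ F] − ℓ^{∅}[e ∈ F] = (t/(1−t²))·⟨σ_xσ_y ; σ_e⟩_G/⟨σ_xσ_y⟩_G`
  (`t = tanh β`; one-edge law + source-cluster/loop-soup fibre decomposition + Griffiths
  monotonicity in the domain), with denominators cleared.
* `stub_thermalOverlapFloor` (lattice, `β_c(3)`, OPEN — the d = 3 input; "ε-exchange floor",
  exponent `3 − 2Δ_ε = 2y_t − 3 = 0.175`): in the free box, on the tetrahedron `l·tetra`,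
  `Σ_{e ⊂ [−l,l]³} ⟨σ₀σ₁;ε_e⟩⟨σ₂σ₃;ε_e⟩ ≥ m₀·⟨σ₀σ₁⟩⟨σ₂σ₃⟩` uniformly in `l ≥ 1`, `N ≥ N₀(l)`.
* `stub_overlapCeiling` (lattice, `β_c(3)`, OPEN — quasi-multiplicativity of the odd-cluster pair
  densities, the "upper-bound direction"): for the edge overlap `N = |E(K₁) ∩ E(K₂) ∩ E([−l,l]³)|`
  of two INDEPENDENT sourced loop configurations `F₁ ~ ℓ^{a₀a₁}`, `F₂ ~ ℓ^{a₂a₃}`,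
  `E[N²] ≤ C·(E[N]² + E[N])`.
* `stub_junkMargin` (lattice, `β_c(3)`; VERBATIM the junk stub of the lead's line `Sketch`, so one
  proof serves both lines): the junk term of the formal crux is a proper fraction `κ < 1` of the
  clean deficit (the residue formal crux ∖ `C′`, Disproof §1–§2).

Composition (proved here, no sorry; `t = tanh β_c(3) > 0` by `criticalBeta_pos_holds` — the
only place where the Disproof's degenerate branch `tanh β_c = 0` is excluded): footprint + GKS II
give `P^{01}[e ∈ K₁]·P^{23}[e ∈ K₂] ≥ (t/(1−t²))²·⟨σ₀σ₁;ε_e⟩⟨σ₂σ₃;ε_e⟩/(G₀₁G₂₃)` edgewise, so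
(Fubini, `firstMoment_eq_edgeSum`) `E[N] ≥ m := (t/(1−t²))²m₀`; Cauchy–Schwarz
`E[N]² ≤ E[N²]·P[N ≥ 1]` (`cs_weighted`) and the ceiling give `P[N ≥ 1] ≥ m/(C(m+1))`
(`joint_lower_of_moments`); a shared cluster edge joins `a₀ ↝ a₂` in `F₁ ∪ F₂`
(`reachable_of_shared_edge`), so `jointSum ≥ c₁·Z₀₁Z₂₃`, `c₁ = m/(C(m+1))` (`joint_lower_core`);
the landed `strandsJoinBound_proof` (Aizenman's identity + `odd ⊆ trace`, p84464) turns this into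
the lattice clause (iii) `INT` with constant `c₁`; `clean_core_loc` (local re-elaboration of the
lead's landed `clean_core`: (★) pair split `stub_pairSplit` p91114 IMPORTED + three-clean +
tetrahedral symmetry, the latter two PROVED in tree p86528/p87103 and re-proved verbatim in
namespace `Landed` below because the hub holds no olean for their modules yet) gives `C′` with
constant `(2/3)c₁`; junk decomposition `lhs_decomposition_loc` + `stub_junkMargin` give
`StrandShadow` with `c′ = (1−κ)(2/3)c₁` (`shadow_line_core`, `StrandShadow_of`).  Lattice
hypotheses are bridged to the generic cores with `convert … using k` (the crux body carries the
Theses file's `Finset.filter` instances).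
-/

noncomputable section

open Finset SimpleGraph
open Literature.Probability.LatticeModels
open Summit.CriticalPhenomena.Ising3DConformalLimit.Theses.FKParityRobustness (StrandShadow)
open Summit.CriticalPhenomena.Ising3DConformalLimit.Theorems

namespace Summit.CriticalPhenomena.Ising3DConformalLimit.Cruxes.StrandShadow.Lines.LoopFootprintStrandMass

open scoped Classical symmDiff


/-! ## The registered stubs -/

/-- **stub_hteToggle** (LANDED p97523 `Theorems.StrandShadowFootprint.stub_hteToggle`; dimension-free; the ONE-EDGE LAW of the high-temperature
expansion in a domain `Λ`).  For an edge `e = uv` of `G` with both endpoints in `Λ` and any source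
set `A`, removing `e` is a weight-`t` bijection from the HT graphs `R ⊆ ℰ_Λ` with `∂R = A`,
`e ∈ R` onto the HT graphs with `∂R = A ∆ {u,v}`, `e ∉ R`:
`Σ_{∂R = A, e ∈ R} t^|R| = t · Σ_{∂R = A ∆ {u,v}, e ∉ R} t^|R|` (`{u,v}` written
`univ.filter (· ∈ e)`; `R ↦ R.erase e`, inverse `insert e`; the degrees at `u`, `v` drop by one).
At `Λ = univ` the index sets are `tJoins G univ ·` (`StrandShadowNegative.tJoins_univ_eq_filter`). -/
theorem stub_hteToggle :
    ∀ (V : Type) [Fintype V] [DecidableEq V] (G : SimpleGraph V) [DecidableRel G.Adj]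
      (Λ A : Finset V) (t : ℝ) (e : Sym2 V), e ∈ edgesIn G Λ →
      (∑ R ∈ ((edgesIn G Λ).powerset.filter fun R : Finset (Sym2 V) => oddVerts Λ R = A).filter
            (fun R : Finset (Sym2 V) => e ∈ R), t ^ R.card)
        = t * ∑ R ∈ ((edgesIn G Λ).powerset.filter fun R : Finset (Sym2 V) =>
              oddVerts Λ R = A ∆ (Finset.univ.filter fun w : V => w ∈ e)).filter
            (fun R : Finset (Sym2 V) => e ∉ R), t ^ R.card := by
  exact StrandShadowFootprint.stub_hteToggle

/-- **stub_hteDomainMono** (LANDED p97543 `Theorems.StrandShadowFootprint.stub_hteDomainMono`; dimension-free; Griffiths' second inequality in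
high-temperature dress).  For `0 ≤ t < 1` and `A ⊆ Λ`:  `g_Λ(A)·g_V(∅) ≤ g_V(A)·g_Λ(∅)`
(`g_Λ = hteSum G Λ t`), i.e. `⟨σ_A⟩^free_Λ ≤ ⟨σ_A⟩^free_V` at `t = tanh β`
(`isingCorr_free_le_of_subset` with `Λ ⊆ univ`, `isingCorr_free_eq_hteSum_div` twice, after
inverting `tanh` on `[0,1)` — `β = ½·log((1+t)/(1−t))` — and clearing the denominators
`g(∅) ≥ 1 > 0`). -/
theorem stub_hteDomainMono :
    ∀ (V : Type) [Fintype V] [DecidableEq V] (G : SimpleGraph V) [DecidableRel G.Adj] (t : ℝ),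
      0 ≤ t → t < 1 → ∀ (Λ A : Finset V), A ⊆ Λ →
      hteSum G Λ t A * hteSum G Finset.univ t ∅ ≤ hteSum G Finset.univ t A * hteSum G Λ t ∅ := by
  exact StrandShadowFootprint.stub_hteDomainMono

/-- **stub_clusterLoopFibre** (LANDED p97987 `Theorems.StrandShadowFootprint.stub_clusterLoopFibre`; dimension-free; the source-cluster / loop-soup fibre
decomposition of the sourced loop measure, evaluated against the indicator "`e` is a LOOP edge of
`F`", i.e. `e ∈ F` but not both endpoints joined to `x`).  Fibring `F ∈ 𝒯(xy)` over its
`x`-cluster `K` (`F = K ⊔ R`, `R` an even subgraph of the depleted domain `Λ_K = {v ∣ ¬ x ↝_K v}`):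
(i) the `t^|F|`-mass of the configurations containing `e` OUTSIDE the `x`-cluster is
`Σ_K t^|K| · Σ_{R ⊆ ℰ_{Λ_K} even, e ∈ R} t^|R|`; (ii) the whole mass `Z^{xy}` is
`Σ_K t^|K| · g_{Λ_K}(∅)` over the SAME cluster index set (self-clustered `K ⊆ E(G)` with
`∂K = {x,y}`, in the vocabulary of `Theorems.DepletionBound`: `sum_avoid_eq_sum_fibres` with
`S = ∅`, `fibre_sum`, `fibre_eval`, `cluster_props`, `rch_cluster_iff`, `disjoint_of_avoid`). -/
theorem stub_clusterLoopFibre :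
    ∀ (V : Type) [Fintype V] [DecidableEq V] (G : SimpleGraph V) [DecidableRel G.Adj] (t : ℝ)
      (x y : V) (e : Sym2 V),
      (∑ F ∈ (tJoins G Set.univ {x, y}).filter (fun F : Finset (Sym2 V) =>
            e ∈ F ∧ ¬ ∀ w ∈ e, (SimpleGraph.fromEdgeSet (↑F : Set (Sym2 V))).Reachable x w),
          t ^ F.card)
        = ∑ K ∈ (G.edgeFinset.powerset.filter fun K : Finset (Sym2 V) =>
              (K.filter fun f : Sym2 V =>
                  ∃ v ∈ f, (SimpleGraph.fromEdgeSet (↑K : Set (Sym2 V))).Reachable x v) = K ∧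
              (∀ v : V, Odd (K.filter fun f : Sym2 V => v ∈ f).card ↔ v ∈ ({x, y} : Finset V))),
            t ^ K.card *
              ∑ R ∈ ((edgesIn G (Finset.univ.filter fun v : V => ¬ (SimpleGraph.fromEdgeSet (↑K : Set (Sym2 V))).Reachable x v)).powerset.filter
                  fun R : Finset (Sym2 V) =>
                    oddVerts (Finset.univ.filter fun v : V => ¬ (SimpleGraph.fromEdgeSet (↑K : Set (Sym2 V))).Reachable x v) R = ∅).filter
                (fun R : Finset (Sym2 V) => e ∈ R), t ^ R.card ∧
      loopO1PartitionFunction G t {x, y}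
        = ∑ K ∈ (G.edgeFinset.powerset.filter fun K : Finset (Sym2 V) =>
              (K.filter fun f : Sym2 V =>
                  ∃ v ∈ f, (SimpleGraph.fromEdgeSet (↑K : Set (Sym2 V))).Reachable x v) = K ∧
              (∀ v : V, Odd (K.filter fun f : Sym2 V => v ∈ f).card ↔ v ∈ ({x, y} : Finset V))),
            t ^ K.card *
              hteSum G (Finset.univ.filter fun v : V => ¬ (SimpleGraph.fromEdgeSet (↑K : Set (Sym2 V))).Reachable x v) t ∅ := by
  exact StrandShadowFootprint.stub_clusterLoopFibre

/-- **stub_thermalOverlapFloor** (OPEN; the d = 3 input of the line — "ε-exchange floor", predicted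
exponent `3 − 2Δ_ε = 2y_t − 3 = +0.175`).  At `β_c(3)`, in the free box `Λ_N`, on the tetrahedron
`a = l·tetra` and the central window `B_l = E([−l,l]³)`:
`m₀·⟨σ_{a₀}σ_{a₁}⟩⟨σ_{a₂}σ_{a₃}⟩ ≤ Σ_{e ∈ B_l} ⟨σ_{a₀}σ_{a₁} ; σ_e⟩·⟨σ_{a₂}σ_{a₃} ; σ_e⟩`
(`σ_e = σ_uσ_v`, truncations `⟨σ_Sσ_e⟩ − ⟨σ_S⟩⟨σ_e⟩ ≥ 0` by GKS II), uniformly in `l ≥ 1`,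
`N ≥ N₀(l)`. -/
theorem stub_thermalOverlapFloor :
    ∃ m₀ : ℝ, 0 < m₀ ∧ ∀ l : ℕ, 1 ≤ l → ∃ N₀ : ℕ, ∀ N : ℕ, N₀ ≤ N → ∀ a : Fin 4 → ↥(box 3 N),
      (∀ i, ((a i : Site 3)) = (l : ℤ) •
        (![![-1, -1, -1], ![1, 1, -1], ![1, -1, 1], ![-1, 1, 1]] : Fin 4 → Site 3) i) →
      (let G := ((zdGraph 3).comap (Subtype.val : ↥(box 3 N) → Site 3))
       let β : ℝ := criticalBeta 3
       let corr : Finset ↥(box 3 N) → ℝ := fun A => isingCorr G Finset.univ β 0 .free A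
       let B : Finset (Sym2 ↥(box 3 N)) :=
         G.edgeFinset.filter fun e => ∀ w ∈ e, ((w : Site 3)) ∈ box 3 l
       m₀ * (corr {a 0, a 1} * corr {a 2, a 3}) ≤
         ∑ e ∈ B,
           (corr (({a 0, a 1} : Finset ↥(box 3 N)) ∆ (Finset.univ.filter fun w => w ∈ e))
               - corr {a 0, a 1} * corr (Finset.univ.filter fun w => w ∈ e)) *
           (corr (({a 2, a 3} : Finset ↥(box 3 N)) ∆ (Finset.univ.filter fun w => w ∈ e))
               - corr {a 2, a 3} * corr (Finset.univ.filter fun w => w ∈ e))) := by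
  sorry

/-- **stub_overlapCeiling** (OPEN; quasi-multiplicativity of the pair densities of the odd
cluster — the new, upper-bound direction).  At `β_c(3)`, in the free box, on `a = l·tetra`, for two
INDEPENDENT sourced loop-O(1) configurations `F₁ ∈ 𝒯(a₀a₁)`, `F₂ ∈ 𝒯(a₂a₃)` (weights
`t^{|F₁|+|F₂|}`, `t = tanh β_c`) and the edge overlap of their source clusters inside the window,
`N(F₁,F₂) = #{e ∈ B_l : e ∈ E(K_{a₀}(F₁)) ∩ E(K_{a₂}(F₂))}`:
`E[N²] ≤ C·(E[N]² + E[N])`, written with cleared normalisation `Z₀₁Z₂₃`: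
`M₂·Z₀₁Z₂₃ ≤ C·(M₁² + M₁·Z₀₁Z₂₃)`, uniformly in `l ≥ 1`, `N ≥ N₀(l)`. -/
theorem stub_overlapCeiling :
    ∃ C : ℝ, 0 < C ∧ ∀ l : ℕ, 1 ≤ l → ∃ N₀ : ℕ, ∀ N : ℕ, N₀ ≤ N → ∀ a : Fin 4 → ↥(box 3 N),
      (∀ i, ((a i : Site 3)) = (l : ℤ) •
        (![![-1, -1, -1], ![1, 1, -1], ![1, -1, 1], ![-1, 1, 1]] : Fin 4 → Site 3) i) →
      (let G := ((zdGraph 3).comap (Subtype.val : ↥(box 3 N) → Site 3))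
       let t : ℝ := Real.tanh (criticalBeta 3)
       let B : Finset (Sym2 ↥(box 3 N)) :=
         G.edgeFinset.filter fun e => ∀ w ∈ e, ((w : Site 3)) ∈ box 3 l
       let Nov : Finset (Sym2 ↥(box 3 N)) → Finset (Sym2 ↥(box 3 N)) → ℝ := fun F₁ F₂ =>
         ((B.filter fun e =>
             (e ∈ F₁ ∧ ∀ w ∈ e, (SimpleGraph.fromEdgeSet (↑F₁ : Set (Sym2 ↥(box 3 N)))).Reachable (a 0) w) ∧
             (e ∈ F₂ ∧ ∀ w ∈ e, (SimpleGraph.fromEdgeSet (↑F₂ : Set (Sym2 ↥(box 3 N)))).Reachable (a 2) w)).card : ℝ)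
       let M₁ : ℝ := ∑ F₁ ∈ tJoins G Set.univ {a 0, a 1}, ∑ F₂ ∈ tJoins G Set.univ {a 2, a 3},
         t ^ (F₁.card + F₂.card) * Nov F₁ F₂
       let M₂ : ℝ := ∑ F₁ ∈ tJoins G Set.univ {a 0, a 1}, ∑ F₂ ∈ tJoins G Set.univ {a 2, a 3},
         t ^ (F₁.card + F₂.card) * Nov F₁ F₂ ^ 2
       let Z : ℝ := loopO1PartitionFunction G t {a 0, a 1} * loopO1PartitionFunction G t {a 2, a 3}
       M₂ * Z ≤ C * (M₁ ^ 2 + M₁ * Z)) := by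
  sorry

/-- **stub_junkMargin** (VERBATIM the stub of the lead's line `Sketch`; misstatement residue
formal crux ∖ `C′`, Disproof §1–§2): there is `κ < 1` such that for every `l ≥ 1` and all large `N`,
on `l·tetra ⊂ Λ_N` at `β_c(3)`, `J ≤ κ·(Z₀₁·G₂₃ − LHS_clean)`, where
`J = Σ_{F ∈ 𝒯₀₁ : a₂,a₃ ∈ V(K_{a₀}F)} t^{|F|}` and `LHS_clean` is the sum of `C′ = StrandShadowClean`.
Numerically `κ ≈ 0.15` (MC j013016, `l = 1`); provable for `l ≥ l₀` from INT + double switching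
+ the infrared bound (`J/(Z₀₁G₂₃) ≤ 3·⟨σ_{a₂}σ_{a₃}⟩ → 0`), numerics-only at small `l`. -/
theorem stub_junkMargin :
    ∃ κ : ℝ, κ < 1 ∧ ∀ l : ℕ, 1 ≤ l → ∃ N₀ : ℕ, ∀ N : ℕ, N₀ ≤ N → ∀ a : Fin 4 → ↥(box 3 N),
      (∀ i, ((a i : Site 3)) = (l : ℤ) •
        (![![-1, -1, -1], ![1, 1, -1], ![1, -1, 1], ![-1, 1, 1]] : Fin 4 → Site 3) i) →
      (let G := ((zdGraph 3).comap (Subtype.val : ↥(box 3 N) → Site 3))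
       let β : ℝ := criticalBeta 3
       let t : ℝ := Real.tanh β
       (∑ F ∈ (tJoins G Set.univ {a 0, a 1}).filter (fun F : Finset (Sym2 ↥(box 3 N)) =>
            (SimpleGraph.fromEdgeSet (↑F : Set (Sym2 ↥(box 3 N)))).Reachable (a 0) (a 2) ∧
            (SimpleGraph.fromEdgeSet (↑F : Set (Sym2 ↥(box 3 N)))).Reachable (a 0) (a 3)),
          t ^ F.card)
         ≤ κ * (loopO1PartitionFunction G t {a 0, a 1} * isingCorr G Finset.univ β 0 .free {a 2, a 3}
             - ∑ F ∈ (tJoins G Set.univ {a 0, a 1}).filter (fun F : Finset (Sym2 ↥(box 3 N)) =>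
                 ¬ (SimpleGraph.fromEdgeSet (↑F : Set (Sym2 ↥(box 3 N)))).Reachable (a 0) (a 2) ∧
                 ¬ (SimpleGraph.fromEdgeSet (↑F : Set (Sym2 ↥(box 3 N)))).Reachable (a 0) (a 3)),
               t ^ F.card * isingCorr G (Finset.univ.filter fun v : ↥(box 3 N) =>
                 ¬ (SimpleGraph.fromEdgeSet (↑F : Set (Sym2 ↥(box 3 N)))).Reachable (a 0) v)
                 β 0 .free {a 2, a 3})) := by
  sorry



/-! ## The footprint floor (LANDED p100356, `Theorems.StrandShadowFootprint.footprintFloor`) -/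

/-- **The footprint floor** — the former registered stub `stub_footprintFloor`, now the landed theorem
`StrandShadowFootprint.footprintFloor` (p100356; from `stub_hteToggle` p97523, `stub_hteDomainMono` p97543,
`stub_clusterLoopFibre` p97987): `t·(Z^∅·Z^{{x,y}∆E_e} − Z^{xy}·Z^{E_e}) ≤ (1 − t²)·Z^∅·Σ_{F ∈ 𝒯(xy) : e ∈ E(K_x(F))} t^|F|`. -/
theorem footprintFloor :
    ∀ (V : Type) [Fintype V] [DecidableEq V] (G : SimpleGraph V) [DecidableRel G.Adj] (t : ℝ),
      0 ≤ t → t < 1 → ∀ (x y : V), x ≠ y → ∀ e ∈ G.edgeFinset,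
      t * (loopO1PartitionFunction G t ∅ *
              loopO1PartitionFunction G t (({x, y} : Finset V) ∆ (Finset.univ.filter fun w : V => w ∈ e))
            - loopO1PartitionFunction G t {x, y} *
              loopO1PartitionFunction G t (Finset.univ.filter fun w : V => w ∈ e))
        ≤ (1 - t ^ 2) * loopO1PartitionFunction G t ∅ *
            ∑ F ∈ (tJoins G Set.univ {x, y}).filter (fun F : Finset (Sym2 V) =>
                e ∈ F ∧ ∀ w ∈ e, (SimpleGraph.fromEdgeSet (↑F : Set (Sym2 V))).Reachable x w),
              t ^ F.card :=
  StrandShadowFootprint.footprintFloor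


/-! ## Local lemmas for the composition (no sorry from here on) -/

section Arith

/-- Weighted Cauchy–Schwarz: `(Σ w N)² ≤ (Σ w N²)·(Σ_{N ≠ 0} w)` for weights `w ≥ 0`
(the Paley–Zygmund numerator/denominator; the `Decidable` instance is unified from the goal). -/
theorem cs_weighted {ι : Type*} (s : Finset ι) (w N : ι → ℝ) {instN : ∀ i, Decidable (N i = 0)}
    (hw : ∀ i ∈ s, 0 ≤ w i) :
    (∑ i ∈ s, w i * N i) ^ 2 ≤
      (∑ i ∈ s, w i * N i ^ 2) * ∑ i ∈ s, (if N i = 0 then 0 else w i) := by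
  refine Finset.sum_sq_le_sum_mul_sum_of_sq_le_mul s
    (fun i hi => mul_nonneg (hw i hi) (sq_nonneg _)) (fun i hi => ?_) (fun i hi => ?_)
  · split_ifs
    · exact le_rfl
    · exact hw i hi
  · split_ifs with h
    · rw [h]; simp
    · exact le_of_eq (by ring)

/-- The real arithmetic of Paley–Zygmund with a first-moment floor `m·Z ≤ M₁` and a
second-moment ceiling `M₂·Z ≤ C(M₁² + M₁Z)`: `JS ≥ (m/(C(m+1)))·Z`. -/
theorem joint_lower_of_moments {JS M₁ M₂ Z m C : ℝ} (hJS : 0 ≤ JS) (hZ : 0 ≤ Z) (hm : 0 < m)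
    (hC : 0 < C) (hCS : M₁ ^ 2 ≤ M₂ * JS) (hceil : M₂ * Z ≤ C * (M₁ ^ 2 + M₁ * Z))
    (hfloor : m * Z ≤ M₁) : m / (C * (m + 1)) * Z ≤ JS := by
  rcases hZ.eq_or_lt with hZ0 | hZpos
  · rw [← hZ0, mul_zero]; exact hJS
  have hM₁ : 0 < M₁ := lt_of_lt_of_le (mul_pos hm hZpos) hfloor
  have hZle : Z ≤ M₁ / m := by
    rw [le_div_iff₀ hm]; linarith
  have h1 : M₁ * Z ≤ M₁ ^ 2 / m := by
    calc M₁ * Z ≤ M₁ * (M₁ / m) := mul_le_mul_of_nonneg_left hZle hM₁.le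
      _ = M₁ ^ 2 / m := by ring
  have h2 : M₂ * Z ≤ C * (1 + 1 / m) * M₁ ^ 2 := by
    calc M₂ * Z ≤ C * (M₁ ^ 2 + M₁ * Z) := hceil
      _ ≤ C * (M₁ ^ 2 + M₁ ^ 2 / m) := mul_le_mul_of_nonneg_left (by linarith) hC.le
      _ = C * (1 + 1 / m) * M₁ ^ 2 := by ring
  have h3 : M₁ ^ 2 * Z ≤ M₁ ^ 2 * (C * (1 + 1 / m) * JS) := by
    calc M₁ ^ 2 * Z ≤ M₂ * JS * Z := mul_le_mul_of_nonneg_right hCS hZ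
      _ = M₂ * Z * JS := by ring
      _ ≤ C * (1 + 1 / m) * M₁ ^ 2 * JS := mul_le_mul_of_nonneg_right h2 hJS
      _ = M₁ ^ 2 * (C * (1 + 1 / m) * JS) := by ring
  have h4 : Z ≤ C * (1 + 1 / m) * JS := le_of_mul_le_mul_left h3 (by positivity)
  have hm' : m ≠ 0 := hm.ne'
  have hC' : C ≠ 0 := hC.ne'
  have hm1 : m + 1 ≠ 0 := (by linarith : (0 : ℝ) < m + 1).ne'
  calc m / (C * (m + 1)) * Z ≤ m / (C * (m + 1)) * (C * (1 + 1 / m) * JS) :=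
        mul_le_mul_of_nonneg_left h4 (by positivity)
    _ = JS := by field_simp

/-- The final real arithmetic: junk split + clean bound + junk margin. -/
theorem shadow_of_clean_junk {L Lc J Z Gc c₁ κ : ℝ} (hL : L = Lc + J)
    (hclean : Lc ≤ (1 - 2 / 3 * c₁) * Z * Gc) (hjunk : J ≤ κ * (Z * Gc - Lc)) (hκ : κ < 1) :
    L ≤ (1 - (1 - κ) * (2 / 3 * c₁)) * Z * Gc := by
  have hκ' : 0 ≤ 1 - κ := by linarith
  have h5 : (1 - κ) * Lc ≤ (1 - κ) * ((1 - 2 / 3 * c₁) * Z * Gc) :=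
    mul_le_mul_of_nonneg_left hclean hκ'
  rw [hL]
  linarith [hjunk, h5]

end Arith

section Fubini

/-- **First moment of the overlap as an edge sum** (Fubini): the weighted count of window
edges lying in both clusters equals the edge sum of the products of the two cluster weights.
(`Decidable` instances are implicit binders, unified from the goal.) -/
theorem firstMoment_eq_edgeSum {ι₁ ι₂ ε : Type*} (T₁ : Finset ι₁) (T₂ : Finset ι₂) (B : Finset ε)
    (w₁ : ι₁ → ℝ) (w₂ : ι₂ → ℝ) (P₁ : ι₁ → ε → Prop) (P₂ : ι₂ → ε → Prop)
    {instP : ∀ F₁ F₂, DecidablePred fun e => P₁ F₁ e ∧ P₂ F₂ e}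
    {instQ₁ : ∀ e, DecidablePred fun F₁ => P₁ F₁ e}
    {instQ₂ : ∀ e, DecidablePred fun F₂ => P₂ F₂ e} :
    (∑ F₁ ∈ T₁, ∑ F₂ ∈ T₂, w₁ F₁ * w₂ F₂ * ((B.filter fun e => P₁ F₁ e ∧ P₂ F₂ e).card : ℝ))
      = ∑ e ∈ B, (∑ F₁ ∈ T₁.filter (fun F₁ => P₁ F₁ e), w₁ F₁) *
          (∑ F₂ ∈ T₂.filter (fun F₂ => P₂ F₂ e), w₂ F₂) := by
  have hcard : ∀ F₁ F₂, w₁ F₁ * w₂ F₂ * ((B.filter fun e => P₁ F₁ e ∧ P₂ F₂ e).card : ℝ) =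
      ∑ e ∈ B, (if P₁ F₁ e then w₁ F₁ else 0) * (if P₂ F₂ e then w₂ F₂ else 0) := by
    intro F₁ F₂
    rw [Finset.card_filter, Nat.cast_sum, Finset.mul_sum]
    refine Finset.sum_congr rfl fun e _ => ?_
    by_cases h1 : P₁ F₁ e
    · by_cases h2 : P₂ F₂ e
      · rw [if_pos ⟨h1, h2⟩, if_pos h1, if_pos h2]; push_cast; ring
      · rw [if_neg (fun h => h2 h.2), if_pos h1, if_neg h2]; push_cast; ring
    · rw [if_neg (fun h => h1 h.1), if_neg h1]; push_cast; ring
  calc (∑ F₁ ∈ T₁, ∑ F₂ ∈ T₂, w₁ F₁ * w₂ F₂ * ((B.filter fun e => P₁ F₁ e ∧ P₂ F₂ e).card : ℝ))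
      = ∑ F₁ ∈ T₁, ∑ F₂ ∈ T₂, ∑ e ∈ B,
          (if P₁ F₁ e then w₁ F₁ else 0) * (if P₂ F₂ e then w₂ F₂ else 0) := by
        refine Finset.sum_congr rfl fun F₁ _ => Finset.sum_congr rfl fun F₂ _ => hcard F₁ F₂
    _ = ∑ F₁ ∈ T₁, ∑ e ∈ B, ∑ F₂ ∈ T₂,
          (if P₁ F₁ e then w₁ F₁ else 0) * (if P₂ F₂ e then w₂ F₂ else 0) := by
        refine Finset.sum_congr rfl fun F₁ _ => Finset.sum_comm
    _ = ∑ e ∈ B, ∑ F₁ ∈ T₁, ∑ F₂ ∈ T₂,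
          (if P₁ F₁ e then w₁ F₁ else 0) * (if P₂ F₂ e then w₂ F₂ else 0) := Finset.sum_comm
    _ = ∑ e ∈ B, (∑ F₁ ∈ T₁.filter (fun F₁ => P₁ F₁ e), w₁ F₁) *
          (∑ F₂ ∈ T₂.filter (fun F₂ => P₂ F₂ e), w₂ F₂) := by
        refine Finset.sum_congr rfl fun e _ => ?_
        rw [Finset.sum_filter, Finset.sum_filter, Finset.sum_mul_sum]

/-- A window edge lying in the `x`-cluster of `F₁` and in the `z`-cluster of `F₂` joins `x` to
`z` inside `F₁ ∪ F₂`. -/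
theorem reachable_of_shared_edge {V : Type*} {F₁ F₂ : Finset (Sym2 V)} {x z : V} {e : Sym2 V}
    (h₁ : ∀ w ∈ e, (SimpleGraph.fromEdgeSet (↑F₁ : Set (Sym2 V))).Reachable x w)
    (h₂ : ∀ w ∈ e, (SimpleGraph.fromEdgeSet (↑F₂ : Set (Sym2 V))).Reachable z w) :
    (SimpleGraph.fromEdgeSet ((↑F₁ : Set (Sym2 V)) ∪ ↑F₂)).Reachable x z := by
  obtain ⟨w, hw⟩ : ∃ w, w ∈ e := by
    induction e using Sym2.ind with
    | _ u v => exact ⟨u, Sym2.mem_mk_left u v⟩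
  exact ((h₁ w hw).mono (fromEdgeSet_mono Set.subset_union_left)).trans
    ((h₂ w hw).mono (fromEdgeSet_mono Set.subset_union_right)).symm

end Fubini

section Core

variable {V : Type*} [Fintype V] [DecidableEq V] (G : SimpleGraph V) [DecidableRel G.Adj]

/-- **Junk decomposition** `LHS = LHS_clean + J` — local copy of
`StrandShadowSketch.lhs_decomposition'` (Composition.lean; adapted from Disproof §1), re-elaborated
here so that the `Finset.filter` instances agree with this file's statements. -/
theorem lhs_decomposition_loc (𝒯 : Finset (Finset (Sym2 V))) (t β : ℝ) (a₀ a₂ a₃ : V) :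
    (∑ F ∈ 𝒯, t ^ F.card * isingCorr G (Finset.univ.filter fun v : V =>
        ¬ (SimpleGraph.fromEdgeSet (↑F : Set (Sym2 V))).Reachable a₀ v) β 0 .free {a₂, a₃}) =
      (∑ F ∈ 𝒯.filter (fun F : Finset (Sym2 V) =>
          ¬ (SimpleGraph.fromEdgeSet (↑F : Set (Sym2 V))).Reachable a₀ a₂ ∧
          ¬ (SimpleGraph.fromEdgeSet (↑F : Set (Sym2 V))).Reachable a₀ a₃),
        t ^ F.card * isingCorr G (Finset.univ.filter fun v : V =>
          ¬ (SimpleGraph.fromEdgeSet (↑F : Set (Sym2 V))).Reachable a₀ v) β 0 .free {a₂, a₃}) +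
      ∑ F ∈ 𝒯.filter (fun F : Finset (Sym2 V) =>
          (SimpleGraph.fromEdgeSet (↑F : Set (Sym2 V))).Reachable a₀ a₂ ∧
          (SimpleGraph.fromEdgeSet (↑F : Set (Sym2 V))).Reachable a₀ a₃), t ^ F.card := by
  set R : Finset (Sym2 V) → V → Prop := fun F v =>
    (SimpleGraph.fromEdgeSet (↑F : Set (Sym2 V))).Reachable a₀ v with hR
  set f : Finset (Sym2 V) → ℝ := fun F => t ^ F.card *
    isingCorr G (Finset.univ.filter fun v : V => ¬ R F v) β 0 .free {a₂, a₃} with hf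
  have hvol : ∀ (F : Finset (Sym2 V)) (v : V), v ∈ (univ.filter fun w : V => ¬ R F w) ↔ ¬ R F v :=
    fun F v => by simp
  rw [← Finset.sum_filter_add_sum_filter_not 𝒯 (fun F => ¬ R F a₂ ∧ ¬ R F a₃) f]
  congr 1
  rw [← Finset.sum_filter_add_sum_filter_not (𝒯.filter fun F => ¬(¬ R F a₂ ∧ ¬ R F a₃))
    (fun F => R F a₂ ∧ R F a₃) f]
  have hboth : (𝒯.filter fun F => ¬(¬ R F a₂ ∧ ¬ R F a₃)).filter (fun F => R F a₂ ∧ R F a₃) =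
      𝒯.filter (fun F => R F a₂ ∧ R F a₃) := by
    ext F; simp only [Finset.mem_filter]; tauto
  have hzero : ∑ F ∈ (𝒯.filter fun F => ¬(¬ R F a₂ ∧ ¬ R F a₃)).filter (fun F => ¬ (R F a₂ ∧ R F a₃)),
      f F = 0 := by
    refine Finset.sum_eq_zero fun F hF => ?_
    simp only [Finset.mem_filter] at hF
    obtain ⟨⟨_, hF1⟩, hF2⟩ := hF
    by_cases h2 : R F a₂
    · have h3 : ¬ R F a₃ := fun h3 => hF2 ⟨h2, h3⟩
      simp only [hf]
      rw [StrandShadowSketch.isingCorr_free_pair_eq_zero' G _ β (by simp [h2]) (by simp [h3]),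
        mul_zero]
    · have h3 : R F a₃ := by
        by_contra h3; exact hF1 ⟨h2, h3⟩
      simp only [hf]
      rw [Finset.pair_comm,
        StrandShadowSketch.isingCorr_free_pair_eq_zero' G _ β (by simp [h3]) (by simp [h2]), mul_zero]
  rw [hzero, add_zero, hboth]
  refine Finset.sum_congr rfl fun F hF => ?_
  simp only [Finset.mem_filter] at hF
  simp only [hf]
  have h2 : a₂ ∉ (Finset.univ.filter fun v : V => ¬ R F v) := by
    rw [hvol, not_not]; exact hF.2.1
  have h3 : a₃ ∉ (Finset.univ.filter fun v : V => ¬ R F v) := by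
    rw [hvol, not_not]; exact hF.2.2
  rw [StrandShadowSketch.isingCorr_free_pair_eq_one' G _ β 0 h2 h3, mul_one]

/-- **Clean transfer `INT → C′` at one scale** — local copy of `StrandShadowSketch.clean_core`
(Composition.lean, lead's line `Sketch`): (★) + three-clean + symmetry turn INT with constant
`c₀` into `LHS_clean ≤ (1 − (2/3)c₀)·Z₀₁·G₂₃`.  Re-elaborated here for instance agreement. -/
theorem clean_core_loc {β c₀ : ℝ} (hβ : 0 ≤ β) (a : Fin 4 → V)
    (hps : (∑ F ∈ (tJoins G Set.univ {a 0, a 1}).filter (fun F : Finset (Sym2 V) =>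
            ¬ (SimpleGraph.fromEdgeSet (↑F : Set (Sym2 V))).Reachable (a 0) (a 2) ∧
            ¬ (SimpleGraph.fromEdgeSet (↑F : Set (Sym2 V))).Reachable (a 0) (a 3)),
          Real.tanh β ^ F.card * isingCorr G (Finset.univ.filter fun v : V =>
            ¬ (SimpleGraph.fromEdgeSet (↑F : Set (Sym2 V))).Reachable (a 0) v) β 0 .free {a 2, a 3})
        = ∑ F ∈ (tJoins G Set.univ (Finset.univ.image a)).filter (fun F : Finset (Sym2 V) =>
            ¬ (SimpleGraph.fromEdgeSet (↑F : Set (Sym2 V))).Reachable (a 0) (a 2) ∧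
            ¬ (SimpleGraph.fromEdgeSet (↑F : Set (Sym2 V))).Reachable (a 0) (a 3)),
          Real.tanh β ^ F.card)
    (htc : (∑ F ∈ (tJoins G Set.univ (Finset.univ.image a)).filter (fun F : Finset (Sym2 V) =>
            ¬ (SimpleGraph.fromEdgeSet (↑F : Set (Sym2 V))).Reachable (a 0) (a 2) ∧
            ¬ (SimpleGraph.fromEdgeSet (↑F : Set (Sym2 V))).Reachable (a 0) (a 3)),
            Real.tanh β ^ F.card) +
      (∑ F ∈ (tJoins G Set.univ (Finset.univ.image a)).filter (fun F : Finset (Sym2 V) =>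
            ¬ (SimpleGraph.fromEdgeSet (↑F : Set (Sym2 V))).Reachable (a 0) (a 1) ∧
            ¬ (SimpleGraph.fromEdgeSet (↑F : Set (Sym2 V))).Reachable (a 0) (a 3)),
            Real.tanh β ^ F.card) +
      (∑ F ∈ (tJoins G Set.univ (Finset.univ.image a)).filter (fun F : Finset (Sym2 V) =>
            ¬ (SimpleGraph.fromEdgeSet (↑F : Set (Sym2 V))).Reachable (a 0) (a 1) ∧
            ¬ (SimpleGraph.fromEdgeSet (↑F : Set (Sym2 V))).Reachable (a 0) (a 2)),
            Real.tanh β ^ F.card)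
        ≤ ∑ F ∈ tJoins G Set.univ (Finset.univ.image a), Real.tanh β ^ F.card)
    (hsym : (let Gc : Fin 4 → Fin 4 → ℝ := fun i j => isingCorr G Finset.univ β 0 .free {a i, a j}
       let C : Fin 4 → Fin 4 → ℝ := fun j k =>
         ∑ F ∈ (tJoins G Set.univ (Finset.univ.image a)).filter (fun F : Finset (Sym2 V) =>
            ¬ (SimpleGraph.fromEdgeSet (↑F : Set (Sym2 V))).Reachable (a 0) (a j) ∧
            ¬ (SimpleGraph.fromEdgeSet (↑F : Set (Sym2 V))).Reachable (a 0) (a k)),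
           Real.tanh β ^ F.card
       Gc 0 2 = Gc 0 1 ∧ Gc 0 3 = Gc 0 1 ∧ Gc 1 3 = Gc 2 3 ∧ Gc 1 2 = Gc 2 3 ∧
         C 1 3 = C 2 3 ∧ C 1 2 = C 2 3))
    (hINT : (let Gc : Fin 4 → Fin 4 → ℝ := fun i j => isingCorr G Finset.univ β 0 .free {a i, a j}
     2 * c₀ * (Gc 0 1 * Gc 2 3) ≤
       Gc 0 1 * Gc 2 3 + Gc 0 2 * Gc 1 3 + Gc 0 3 * Gc 1 2
         - isingCorr G Finset.univ β 0 .free (Finset.univ.image a))) :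
    (∑ F ∈ (tJoins G Set.univ {a 0, a 1}).filter (fun F : Finset (Sym2 V) =>
            ¬ (SimpleGraph.fromEdgeSet (↑F : Set (Sym2 V))).Reachable (a 0) (a 2) ∧
            ¬ (SimpleGraph.fromEdgeSet (↑F : Set (Sym2 V))).Reachable (a 0) (a 3)),
          Real.tanh β ^ F.card * isingCorr G (Finset.univ.filter fun v : V =>
            ¬ (SimpleGraph.fromEdgeSet (↑F : Set (Sym2 V))).Reachable (a 0) v) β 0 .free {a 2, a 3})
      ≤ (1 - 2 / 3 * c₀) * loopO1PartitionFunction G (Real.tanh β) {a 0, a 1} *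
          isingCorr G Finset.univ β 0 .free {a 2, a 3} := by
  simp only at hsym hINT
  obtain ⟨hs02, hs03, hs13, hs12, hsC13, hsC12⟩ := hsym
  have ht : 0 ≤ Real.tanh β := by
    rw [Real.tanh_eq_sinh_div_cosh]
    exact div_nonneg (Real.sinh_nonneg_iff.2 hβ) (Real.cosh_pos _).le
  have hZ0pos : 0 < loopO1PartitionFunction G (Real.tanh β) ∅ :=
    loopO1PartitionFunction_empty_pos G ht
  have hdict01 := StrandShadowSketch.isingCorr_univ_mul_loopO1_empty G β {a 0, a 1}
  have hdictA : isingCorr G Finset.univ β 0 .free (Finset.univ.image a) *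
      loopO1PartitionFunction G (Real.tanh β) ∅ =
        ∑ F ∈ tJoins G Set.univ (Finset.univ.image a), Real.tanh β ^ F.card := by
    rw [StrandShadowSketch.isingCorr_univ_mul_loopO1_empty G β,
      DepletionBound.loopO1PartitionFunction_eq_hteSum, DepletionBound.sum_tJoins_pow_eq_hteSum]
  rw [hs02, hs03, hs13, hs12] at hINT
  rw [hps]
  set σA := isingCorr G Finset.univ β 0 .free (Finset.univ.image a)
  set G01 := isingCorr G Finset.univ β 0 .free {a 0, a 1}
  set G23 := isingCorr G Finset.univ β 0 .free {a 2, a 3}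
  set Z0 := loopO1PartitionFunction G (Real.tanh β) ∅
  have hINT' : σA ≤ (3 - 2 * c₀) * (G01 * G23) := by linarith
  have h3 : 3 * (∑ F ∈ (tJoins G Set.univ (Finset.univ.image a)).filter (fun F : Finset (Sym2 V) =>
      ¬ (SimpleGraph.fromEdgeSet (↑F : Set (Sym2 V))).Reachable (a 0) (a 2) ∧
      ¬ (SimpleGraph.fromEdgeSet (↑F : Set (Sym2 V))).Reachable (a 0) (a 3)), Real.tanh β ^ F.card)
        ≤ σA * Z0 := by
    rw [hdictA]; linarith [htc, hsC13, hsC12]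
  have h4 : σA * Z0 ≤ (3 - 2 * c₀) * (loopO1PartitionFunction G (Real.tanh β) {a 0, a 1} * G23) :=
    calc σA * Z0 ≤ (3 - 2 * c₀) * (G01 * G23) * Z0 := mul_le_mul_of_nonneg_right hINT' hZ0pos.le
      _ = (3 - 2 * c₀) * (loopO1PartitionFunction G (Real.tanh β) {a 0, a 1} * G23) := by
        rw [← hdict01]; ring
  linarith [h3, h4]

/-- **Finite-graph core of the Paley–Zygmund chain.**  On any finite graph, at `t = tanh β > 0`:
the two footprint floors (instances of `stub_footprintFloor` at the two source pairs), a thermal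
overlap floor with constant `m₀` (the shape of `stub_thermalOverlapFloor`) and an overlap
ceiling with constant `C` (the shape of `stub_overlapCeiling`) on a window `B` give
`jointSum ≥ c₁·Z₀₁Z₂₃` with `c₁ = m/(C(m+1))`, `m = (t/(1−t²))²·m₀`. -/
theorem joint_lower_core {β m₀ C : ℝ} (hβ : 0 ≤ β) (ht0 : 0 < Real.tanh β) (hm₀ : 0 < m₀)
    (hC : 0 < C) (a : Fin 4 → V) (B : Finset (Sym2 V))
    (hfoot₁ : ∀ e ∈ B,
      Real.tanh β * (loopO1PartitionFunction G (Real.tanh β) ∅ *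
            loopO1PartitionFunction G (Real.tanh β)
              (({a 0, a 1} : Finset V) ∆ (Finset.univ.filter fun w : V => w ∈ e))
          - loopO1PartitionFunction G (Real.tanh β) {a 0, a 1} *
            loopO1PartitionFunction G (Real.tanh β) (Finset.univ.filter fun w : V => w ∈ e))
        ≤ (1 - Real.tanh β ^ 2) * loopO1PartitionFunction G (Real.tanh β) ∅ *
          ∑ F ∈ (tJoins G Set.univ {a 0, a 1}).filter (fun F : Finset (Sym2 V) =>
              e ∈ F ∧ ∀ w ∈ e, (SimpleGraph.fromEdgeSet (↑F : Set (Sym2 V))).Reachable (a 0) w),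
            Real.tanh β ^ F.card)
    (hfoot₂ : ∀ e ∈ B,
      Real.tanh β * (loopO1PartitionFunction G (Real.tanh β) ∅ *
            loopO1PartitionFunction G (Real.tanh β)
              (({a 2, a 3} : Finset V) ∆ (Finset.univ.filter fun w : V => w ∈ e))
          - loopO1PartitionFunction G (Real.tanh β) {a 2, a 3} *
            loopO1PartitionFunction G (Real.tanh β) (Finset.univ.filter fun w : V => w ∈ e))
        ≤ (1 - Real.tanh β ^ 2) * loopO1PartitionFunction G (Real.tanh β) ∅ *
          ∑ F ∈ (tJoins G Set.univ {a 2, a 3}).filter (fun F : Finset (Sym2 V) =>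
              e ∈ F ∧ ∀ w ∈ e, (SimpleGraph.fromEdgeSet (↑F : Set (Sym2 V))).Reachable (a 2) w),
            Real.tanh β ^ F.card)
    (hfloor : m₀ * (isingCorr G Finset.univ β 0 .free {a 0, a 1} *
        isingCorr G Finset.univ β 0 .free {a 2, a 3}) ≤
      ∑ e ∈ B,
        (isingCorr G Finset.univ β 0 .free
              (({a 0, a 1} : Finset V) ∆ (Finset.univ.filter fun w : V => w ∈ e))
            - isingCorr G Finset.univ β 0 .free {a 0, a 1} *
              isingCorr G Finset.univ β 0 .free (Finset.univ.filter fun w : V => w ∈ e)) *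
        (isingCorr G Finset.univ β 0 .free
              (({a 2, a 3} : Finset V) ∆ (Finset.univ.filter fun w : V => w ∈ e))
            - isingCorr G Finset.univ β 0 .free {a 2, a 3} *
              isingCorr G Finset.univ β 0 .free (Finset.univ.filter fun w : V => w ∈ e)))
    (hceil :
      (∑ F₁ ∈ tJoins G Set.univ {a 0, a 1}, ∑ F₂ ∈ tJoins G Set.univ {a 2, a 3},
          Real.tanh β ^ (F₁.card + F₂.card) *
            ((B.filter fun e =>
                (e ∈ F₁ ∧ ∀ w ∈ e, (SimpleGraph.fromEdgeSet (↑F₁ : Set (Sym2 V))).Reachable (a 0) w) ∧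
                (e ∈ F₂ ∧ ∀ w ∈ e, (SimpleGraph.fromEdgeSet (↑F₂ : Set (Sym2 V))).Reachable (a 2) w)).card
              : ℝ) ^ 2) *
        (loopO1PartitionFunction G (Real.tanh β) {a 0, a 1} *
          loopO1PartitionFunction G (Real.tanh β) {a 2, a 3}) ≤
      C * ((∑ F₁ ∈ tJoins G Set.univ {a 0, a 1}, ∑ F₂ ∈ tJoins G Set.univ {a 2, a 3},
              Real.tanh β ^ (F₁.card + F₂.card) *
                ((B.filter fun e =>
                    (e ∈ F₁ ∧ ∀ w ∈ e, (SimpleGraph.fromEdgeSet (↑F₁ : Set (Sym2 V))).Reachable (a 0) w) ∧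
                    (e ∈ F₂ ∧ ∀ w ∈ e, (SimpleGraph.fromEdgeSet (↑F₂ : Set (Sym2 V))).Reachable (a 2) w)).card
                  : ℝ)) ^ 2 +
            (∑ F₁ ∈ tJoins G Set.univ {a 0, a 1}, ∑ F₂ ∈ tJoins G Set.univ {a 2, a 3},
              Real.tanh β ^ (F₁.card + F₂.card) *
                ((B.filter fun e =>
                    (e ∈ F₁ ∧ ∀ w ∈ e, (SimpleGraph.fromEdgeSet (↑F₁ : Set (Sym2 V))).Reachable (a 0) w) ∧
                    (e ∈ F₂ ∧ ∀ w ∈ e, (SimpleGraph.fromEdgeSet (↑F₂ : Set (Sym2 V))).Reachable (a 2) w)).card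
                  : ℝ)) *
            (loopO1PartitionFunction G (Real.tanh β) {a 0, a 1} *
              loopO1PartitionFunction G (Real.tanh β) {a 2, a 3}))) :
    (Real.tanh β / (1 - Real.tanh β ^ 2)) ^ 2 * m₀ /
        (C * ((Real.tanh β / (1 - Real.tanh β ^ 2)) ^ 2 * m₀ + 1)) *
      (loopO1PartitionFunction G (Real.tanh β) {a 0, a 1} *
        loopO1PartitionFunction G (Real.tanh β) {a 2, a 3}) ≤
    ∑ F₁ ∈ tJoins G Set.univ {a 0, a 1}, ∑ F₂ ∈ tJoins G Set.univ {a 2, a 3},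
      if (SimpleGraph.fromEdgeSet ((↑F₁ : Set (Sym2 V)) ∪ ↑F₂)).Reachable (a 0) (a 2)
      then Real.tanh β ^ (F₁.card + F₂.card) else 0 := by
  -- abbreviations (closed terms only; predicates stay verbatim so that instances coincide)
  set t := Real.tanh β with ht_def
  set Z0 := loopO1PartitionFunction G t ∅ with hZ0_def
  set Z01 := loopO1PartitionFunction G t {a 0, a 1} with hZ01_def
  set Z23 := loopO1PartitionFunction G t {a 2, a 3} with hZ23_def
  set T₁ := tJoins G Set.univ {a 0, a 1} with hT₁_def
  set T₂ := tJoins G Set.univ {a 2, a 3} with hT₂_def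
  set c01 := isingCorr G Finset.univ β 0 .free {a 0, a 1} with hc01_def
  set c23 := isingCorr G Finset.univ β 0 .free {a 2, a 3} with hc23_def
  set Nov : Finset (Sym2 V) → Finset (Sym2 V) → ℝ := fun F₁ F₂ =>
    ((B.filter fun e =>
        (e ∈ F₁ ∧ ∀ w ∈ e, (SimpleGraph.fromEdgeSet (↑F₁ : Set (Sym2 V))).Reachable (a 0) w) ∧
        (e ∈ F₂ ∧ ∀ w ∈ e, (SimpleGraph.fromEdgeSet (↑F₂ : Set (Sym2 V))).Reachable (a 2) w)).card : ℝ)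
    with hNov_def
  set M₁ : ℝ := ∑ F₁ ∈ T₁, ∑ F₂ ∈ T₂, t ^ (F₁.card + F₂.card) * Nov F₁ F₂ with hM₁_def
  set M₂ : ℝ := ∑ F₁ ∈ T₁, ∑ F₂ ∈ T₂, t ^ (F₁.card + F₂.card) * Nov F₁ F₂ ^ 2 with hM₂_def
  set JS : ℝ := ∑ F₁ ∈ T₁, ∑ F₂ ∈ T₂,
    (if (SimpleGraph.fromEdgeSet ((↑F₁ : Set (Sym2 V)) ∪ ↑F₂)).Reachable (a 0) (a 2)
      then t ^ (F₁.card + F₂.card) else 0) with hJS_def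
  set X₁ : Sym2 V → ℝ := fun e => ∑ F ∈ T₁.filter (fun F : Finset (Sym2 V) =>
      e ∈ F ∧ ∀ w ∈ e, (SimpleGraph.fromEdgeSet (↑F : Set (Sym2 V))).Reachable (a 0) w),
    t ^ F.card with hX₁_def
  set X₂ : Sym2 V → ℝ := fun e => ∑ F ∈ T₂.filter (fun F : Finset (Sym2 V) =>
      e ∈ F ∧ ∀ w ∈ e, (SimpleGraph.fromEdgeSet (↑F : Set (Sym2 V))).Reachable (a 2) w),
    t ^ F.card with hX₂_def
  set D₁ : Sym2 V → ℝ := fun e =>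
    isingCorr G Finset.univ β 0 .free
        (({a 0, a 1} : Finset V) ∆ (Finset.univ.filter fun w : V => w ∈ e))
      - c01 * isingCorr G Finset.univ β 0 .free (Finset.univ.filter fun w : V => w ∈ e)
    with hD₁_def
  set D₂ : Sym2 V → ℝ := fun e =>
    isingCorr G Finset.univ β 0 .free
        (({a 2, a 3} : Finset V) ∆ (Finset.univ.filter fun w : V => w ∈ e))
      - c23 * isingCorr G Finset.univ β 0 .free (Finset.univ.filter fun w : V => w ∈ e)
    with hD₂_def
  -- signs and positivity
  have ht : 0 ≤ t := ht0.le
  have ht1 : t < 1 := Real.tanh_lt_one β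
  have h1t : 0 < 1 - t ^ 2 := by nlinarith
  have h1t' : 1 - t ^ 2 ≠ 0 := h1t.ne'
  have hZ0 : 0 < Z0 := loopO1PartitionFunction_empty_pos G ht
  have hZ01 : 0 ≤ Z01 := loopO1PartitionFunction_nonneg G ht _
  have hZ23 : 0 ≤ Z23 := loopO1PartitionFunction_nonneg G ht _
  have hX₁ : ∀ e, 0 ≤ X₁ e := fun e => Finset.sum_nonneg fun F _ => pow_nonneg ht _
  have hX₂ : ∀ e, 0 ≤ X₂ e := fun e => Finset.sum_nonneg fun F _ => pow_nonneg ht _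
  -- HT dictionary `⟨σ_A⟩·Z⁰ = Z^A` and the GKS II sign of the truncations
  have hd : ∀ A : Finset V, isingCorr G Finset.univ β 0 .free A * Z0 =
      loopO1PartitionFunction G t A :=
    fun A => StrandShadowSketch.isingCorr_univ_mul_loopO1_empty G β A
  have hgks : ∀ S E : Finset V, isingCorr G Finset.univ β 0 .free S *
      isingCorr G Finset.univ β 0 .free E ≤ isingCorr G Finset.univ β 0 .free (S ∆ E) :=
    fun S E => GKSInequalities.gks_two_holds G (Λ := Finset.univ) (A := S) (B := E) (β := β)
      (h := 0) (bc := .free) hβ le_rfl (Or.inl rfl) (Finset.subset_univ _) (Finset.subset_univ _)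
  have hD₁ : ∀ e, 0 ≤ D₁ e := fun e => sub_nonneg.2 (hgks _ _)
  have hD₂ : ∀ e, 0 ≤ D₂ e := fun e => sub_nonneg.2 (hgks _ _)
  -- Step 1: edgewise, `X_i(e) ≥ κ₀·D_i(e)` with `κ₀ = t·Z⁰/(1−t²)`
  set κ₀ : ℝ := t * Z0 / (1 - t ^ 2) with hκ₀_def
  have hκ₀ : 0 ≤ κ₀ := div_nonneg (mul_nonneg ht hZ0.le) h1t.le
  have hstep : ∀ (S : Finset V) (x : V) (e : Sym2 V),
      t * (Z0 * loopO1PartitionFunction G t (S ∆ (Finset.univ.filter fun w : V => w ∈ e))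
          - loopO1PartitionFunction G t S *
            loopO1PartitionFunction G t (Finset.univ.filter fun w : V => w ∈ e))
        ≤ (1 - t ^ 2) * Z0 *
          ∑ F ∈ (tJoins G Set.univ S).filter (fun F : Finset (Sym2 V) =>
              e ∈ F ∧ ∀ w ∈ e, (SimpleGraph.fromEdgeSet (↑F : Set (Sym2 V))).Reachable x w),
            t ^ F.card →
      κ₀ * (isingCorr G Finset.univ β 0 .free (S ∆ (Finset.univ.filter fun w : V => w ∈ e))
          - isingCorr G Finset.univ β 0 .free S *
            isingCorr G Finset.univ β 0 .free (Finset.univ.filter fun w : V => w ∈ e))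
        ≤ ∑ F ∈ (tJoins G Set.univ S).filter (fun F : Finset (Sym2 V) =>
              e ∈ F ∧ ∀ w ∈ e, (SimpleGraph.fromEdgeSet (↑F : Set (Sym2 V))).Reachable x w),
            t ^ F.card := by
    intro S x e h
    have eSE := hd (S ∆ (Finset.univ.filter fun w : V => w ∈ e))
    have eS := hd S
    have eE := hd (Finset.univ.filter fun w : V => w ∈ e)
    rw [← eSE, ← eS, ← eE] at h
    -- h : t * (Z0 * (cSE * Z0) - cS * Z0 * (cE * Z0)) ≤ (1 - t²) * Z0 * X
    have h' : (t * Z0) *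
        (isingCorr G Finset.univ β 0 .free (S ∆ (Finset.univ.filter fun w : V => w ∈ e))
          - isingCorr G Finset.univ β 0 .free S *
            isingCorr G Finset.univ β 0 .free (Finset.univ.filter fun w : V => w ∈ e)) * Z0
        ≤ ((1 - t ^ 2) *
          ∑ F ∈ (tJoins G Set.univ S).filter (fun F : Finset (Sym2 V) =>
              e ∈ F ∧ ∀ w ∈ e, (SimpleGraph.fromEdgeSet (↑F : Set (Sym2 V))).Reachable x w),
            t ^ F.card) * Z0 := by
      refine le_trans (le_of_eq ?_) (le_trans h (le_of_eq ?_)) <;> ring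
    have h'' := le_of_mul_le_mul_right h' hZ0
    rw [hκ₀_def, div_mul_eq_mul_div, div_le_iff₀ h1t]
    linarith [h'']
  have hE₁ : ∀ e ∈ B, κ₀ * D₁ e ≤ X₁ e := fun e he => hstep {a 0, a 1} (a 0) e (hfoot₁ e he)
  have hE₂ : ∀ e ∈ B, κ₀ * D₂ e ≤ X₂ e := fun e he => hstep {a 2, a 3} (a 2) e (hfoot₂ e he)
  -- Step 2: first moment `M₁ = Σ_e X₁X₂ ≥ κ₀²·Σ_e D₁D₂ ≥ κ₀²·m₀·c₀₁c₂₃ = m·Z₀₁Z₂₃`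
  have hF : (∑ F₁ ∈ T₁, ∑ F₂ ∈ T₂, t ^ F₁.card * t ^ F₂.card * Nov F₁ F₂)
      = ∑ e ∈ B, X₁ e * X₂ e :=
    firstMoment_eq_edgeSum T₁ T₂ B (fun F : Finset (Sym2 V) => t ^ F.card)
      (fun F : Finset (Sym2 V) => t ^ F.card)
      (fun (F : Finset (Sym2 V)) (e : Sym2 V) =>
        e ∈ F ∧ ∀ w ∈ e, (SimpleGraph.fromEdgeSet (↑F : Set (Sym2 V))).Reachable (a 0) w)
      (fun (F : Finset (Sym2 V)) (e : Sym2 V) =>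
        e ∈ F ∧ ∀ w ∈ e, (SimpleGraph.fromEdgeSet (↑F : Set (Sym2 V))).Reachable (a 2) w)
  have hM₁eq : M₁ = ∑ e ∈ B, X₁ e * X₂ e := by
    rw [← hF, hM₁_def]
    refine Finset.sum_congr rfl fun F₁ _ => Finset.sum_congr rfl fun F₂ _ => ?_
    rw [pow_add]
  have hfloorM : (t / (1 - t ^ 2)) ^ 2 * m₀ * (Z01 * Z23) ≤ M₁ := by
    have hsum : ∑ e ∈ B, κ₀ ^ 2 * (D₁ e * D₂ e) ≤ ∑ e ∈ B, X₁ e * X₂ e := by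
      refine Finset.sum_le_sum fun e he => ?_
      calc κ₀ ^ 2 * (D₁ e * D₂ e) = (κ₀ * D₁ e) * (κ₀ * D₂ e) := by ring
        _ ≤ X₁ e * X₂ e :=
          mul_le_mul (hE₁ e he) (hE₂ e he) (mul_nonneg hκ₀ (hD₂ e)) (hX₁ e)
    rw [← Finset.mul_sum] at hsum
    have hfl : κ₀ ^ 2 * (m₀ * (c01 * c23)) ≤ κ₀ ^ 2 * ∑ e ∈ B, D₁ e * D₂ e :=
      mul_le_mul_of_nonneg_left hfloor (sq_nonneg _)
    have hZ01' : Z01 = c01 * Z0 := (hd {a 0, a 1}).symm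
    have hZ23' : Z23 = c23 * Z0 := (hd {a 2, a 3}).symm
    have hid : (t / (1 - t ^ 2)) ^ 2 * m₀ * (Z01 * Z23) = κ₀ ^ 2 * (m₀ * (c01 * c23)) := by
      rw [hZ01', hZ23', hκ₀_def]
      field_simp
    rw [hid, hM₁eq]
    exact hfl.trans hsum
  -- Step 3: Cauchy–Schwarz on the product index set and `N ≥ 1 ⇒ a₀ ↝ a₂`
  have hTw : ∀ p ∈ T₁ ×ˢ T₂, 0 ≤ t ^ (p.1.card + p.2.card) := fun p _ => pow_nonneg ht _
  have hCS0 : (∑ p ∈ T₁ ×ˢ T₂, t ^ (p.1.card + p.2.card) * Nov p.1 p.2) ^ 2 ≤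
      (∑ p ∈ T₁ ×ˢ T₂, t ^ (p.1.card + p.2.card) * Nov p.1 p.2 ^ 2) *
        ∑ p ∈ T₁ ×ˢ T₂, (if Nov p.1 p.2 = 0 then 0 else t ^ (p.1.card + p.2.card)) :=
    cs_weighted (T₁ ×ˢ T₂) (fun p => t ^ (p.1.card + p.2.card)) (fun p => Nov p.1 p.2) hTw
  have hM₁prod : ∑ p ∈ T₁ ×ˢ T₂, t ^ (p.1.card + p.2.card) * Nov p.1 p.2 = M₁ :=
    Finset.sum_product' T₁ T₂ (fun F₁ F₂ => t ^ (F₁.card + F₂.card) * Nov F₁ F₂)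
  have hM₂prod : ∑ p ∈ T₁ ×ˢ T₂, t ^ (p.1.card + p.2.card) * Nov p.1 p.2 ^ 2 = M₂ :=
    Finset.sum_product' T₁ T₂ (fun F₁ F₂ => t ^ (F₁.card + F₂.card) * Nov F₁ F₂ ^ 2)
  have hJSprod : ∑ p ∈ T₁ ×ˢ T₂,
      (if (SimpleGraph.fromEdgeSet ((↑p.1 : Set (Sym2 V)) ∪ ↑p.2)).Reachable (a 0) (a 2)
        then t ^ (p.1.card + p.2.card) else 0) = JS :=
    Finset.sum_product' T₁ T₂ (fun F₁ F₂ =>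
      if (SimpleGraph.fromEdgeSet ((↑F₁ : Set (Sym2 V)) ∪ ↑F₂)).Reachable (a 0) (a 2)
        then t ^ (F₁.card + F₂.card) else 0)
  have hind : ∑ p ∈ T₁ ×ˢ T₂, (if Nov p.1 p.2 = 0 then 0 else t ^ (p.1.card + p.2.card))
      ≤ JS := by
    rw [← hJSprod]
    refine Finset.sum_le_sum fun p hp => ?_
    by_cases hN : Nov p.1 p.2 = 0
    · rw [if_pos hN]
      split_ifs
      · exact pow_nonneg ht _
      · exact le_rfl
    · rw [if_neg hN]
      have hne : (B.filter fun e =>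
          (e ∈ p.1 ∧ ∀ w ∈ e, (SimpleGraph.fromEdgeSet (↑p.1 : Set (Sym2 V))).Reachable (a 0) w) ∧
          (e ∈ p.2 ∧ ∀ w ∈ e, (SimpleGraph.fromEdgeSet (↑p.2 : Set (Sym2 V))).Reachable (a 2) w)).Nonempty := by
        rw [Finset.nonempty_iff_ne_empty]
        intro h0
        apply hN
        simp only [hNov_def, h0, Finset.card_empty, Nat.cast_zero]
      obtain ⟨e, he⟩ := hne
      rw [Finset.mem_filter] at he
      obtain ⟨-, ⟨-, h1⟩, ⟨-, h2⟩⟩ := he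
      rw [if_pos (reachable_of_shared_edge h1 h2)]
  have hJS0 : 0 ≤ JS := by
    refine Finset.sum_nonneg fun F₁ _ => Finset.sum_nonneg fun F₂ _ => ?_
    split_ifs
    · exact pow_nonneg ht _
    · exact le_rfl
  have hM₂0 : 0 ≤ M₂ :=
    Finset.sum_nonneg fun F₁ _ => Finset.sum_nonneg fun F₂ _ =>
      mul_nonneg (pow_nonneg ht _) (sq_nonneg _)
  have hCS : M₁ ^ 2 ≤ M₂ * JS := by
    rw [hM₁prod, hM₂prod] at hCS0
    exact hCS0.trans (mul_le_mul_of_nonneg_left hind hM₂0)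
  -- Step 4: the real arithmetic
  have hm : 0 < (t / (1 - t ^ 2)) ^ 2 * m₀ := mul_pos (pow_pos (div_pos ht0 h1t) 2) hm₀
  exact joint_lower_of_moments hJS0 (mul_nonneg hZ01 hZ23) hm hC hCS hceil hfloorM

/-- **Finite-graph composition of the line.**  On any finite graph, at `t = tanh β > 0`, for an
injective `a` and a window `B`: the PZ inputs of `joint_lower_core`, the pair-split identity
`hps`, three-clean `htc`, the six symmetry equalities `hsym` (the landed stubs of line `Sketch`),
a junk margin `hjunk` with `κ < 1` and the strands-join bound `hSJB` (`U₄·Z⁰² ≤ −2·jointSum`,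
the landed `strandsJoinBound_proof`) give the shadow inequality with constant
`(1 − κ)·(2/3)·c₁`, `c₁ = m/(C(m+1))`, `m = (t/(1−t²))²m₀`. -/
theorem shadow_line_core {β m₀ C κ : ℝ} (hβ : 0 ≤ β) (ht0 : 0 < Real.tanh β) (hm₀ : 0 < m₀)
    (hC : 0 < C) (hκ : κ < 1) (a : Fin 4 → V) (ha : Function.Injective a) (B : Finset (Sym2 V))
    (hfoot₁ : ∀ e ∈ B,
      Real.tanh β * (loopO1PartitionFunction G (Real.tanh β) ∅ *
            loopO1PartitionFunction G (Real.tanh β)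
              (({a 0, a 1} : Finset V) ∆ (Finset.univ.filter fun w : V => w ∈ e))
          - loopO1PartitionFunction G (Real.tanh β) {a 0, a 1} *
            loopO1PartitionFunction G (Real.tanh β) (Finset.univ.filter fun w : V => w ∈ e))
        ≤ (1 - Real.tanh β ^ 2) * loopO1PartitionFunction G (Real.tanh β) ∅ *
          ∑ F ∈ (tJoins G Set.univ {a 0, a 1}).filter (fun F : Finset (Sym2 V) =>
              e ∈ F ∧ ∀ w ∈ e, (SimpleGraph.fromEdgeSet (↑F : Set (Sym2 V))).Reachable (a 0) w),
            Real.tanh β ^ F.card)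
    (hfoot₂ : ∀ e ∈ B,
      Real.tanh β * (loopO1PartitionFunction G (Real.tanh β) ∅ *
            loopO1PartitionFunction G (Real.tanh β)
              (({a 2, a 3} : Finset V) ∆ (Finset.univ.filter fun w : V => w ∈ e))
          - loopO1PartitionFunction G (Real.tanh β) {a 2, a 3} *
            loopO1PartitionFunction G (Real.tanh β) (Finset.univ.filter fun w : V => w ∈ e))
        ≤ (1 - Real.tanh β ^ 2) * loopO1PartitionFunction G (Real.tanh β) ∅ *
          ∑ F ∈ (tJoins G Set.univ {a 2, a 3}).filter (fun F : Finset (Sym2 V) =>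
              e ∈ F ∧ ∀ w ∈ e, (SimpleGraph.fromEdgeSet (↑F : Set (Sym2 V))).Reachable (a 2) w),
            Real.tanh β ^ F.card)
    (hfloor : m₀ * (isingCorr G Finset.univ β 0 .free {a 0, a 1} *
        isingCorr G Finset.univ β 0 .free {a 2, a 3}) ≤
      ∑ e ∈ B,
        (isingCorr G Finset.univ β 0 .free
              (({a 0, a 1} : Finset V) ∆ (Finset.univ.filter fun w : V => w ∈ e))
            - isingCorr G Finset.univ β 0 .free {a 0, a 1} *
              isingCorr G Finset.univ β 0 .free (Finset.univ.filter fun w : V => w ∈ e)) *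
        (isingCorr G Finset.univ β 0 .free
              (({a 2, a 3} : Finset V) ∆ (Finset.univ.filter fun w : V => w ∈ e))
            - isingCorr G Finset.univ β 0 .free {a 2, a 3} *
              isingCorr G Finset.univ β 0 .free (Finset.univ.filter fun w : V => w ∈ e)))
    (hceil :
      (∑ F₁ ∈ tJoins G Set.univ {a 0, a 1}, ∑ F₂ ∈ tJoins G Set.univ {a 2, a 3},
          Real.tanh β ^ (F₁.card + F₂.card) *
            ((B.filter fun e =>
                (e ∈ F₁ ∧ ∀ w ∈ e, (SimpleGraph.fromEdgeSet (↑F₁ : Set (Sym2 V))).Reachable (a 0) w) ∧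
                (e ∈ F₂ ∧ ∀ w ∈ e, (SimpleGraph.fromEdgeSet (↑F₂ : Set (Sym2 V))).Reachable (a 2) w)).card
              : ℝ) ^ 2) *
        (loopO1PartitionFunction G (Real.tanh β) {a 0, a 1} *
          loopO1PartitionFunction G (Real.tanh β) {a 2, a 3}) ≤
      C * ((∑ F₁ ∈ tJoins G Set.univ {a 0, a 1}, ∑ F₂ ∈ tJoins G Set.univ {a 2, a 3},
              Real.tanh β ^ (F₁.card + F₂.card) *
                ((B.filter fun e =>
                    (e ∈ F₁ ∧ ∀ w ∈ e, (SimpleGraph.fromEdgeSet (↑F₁ : Set (Sym2 V))).Reachable (a 0) w) ∧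
                    (e ∈ F₂ ∧ ∀ w ∈ e, (SimpleGraph.fromEdgeSet (↑F₂ : Set (Sym2 V))).Reachable (a 2) w)).card
                  : ℝ)) ^ 2 +
            (∑ F₁ ∈ tJoins G Set.univ {a 0, a 1}, ∑ F₂ ∈ tJoins G Set.univ {a 2, a 3},
              Real.tanh β ^ (F₁.card + F₂.card) *
                ((B.filter fun e =>
                    (e ∈ F₁ ∧ ∀ w ∈ e, (SimpleGraph.fromEdgeSet (↑F₁ : Set (Sym2 V))).Reachable (a 0) w) ∧
                    (e ∈ F₂ ∧ ∀ w ∈ e, (SimpleGraph.fromEdgeSet (↑F₂ : Set (Sym2 V))).Reachable (a 2) w)).card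
                  : ℝ)) *
            (loopO1PartitionFunction G (Real.tanh β) {a 0, a 1} *
              loopO1PartitionFunction G (Real.tanh β) {a 2, a 3})))
    (hps : (∑ F ∈ (tJoins G Set.univ {a 0, a 1}).filter (fun F : Finset (Sym2 V) =>
            ¬ (SimpleGraph.fromEdgeSet (↑F : Set (Sym2 V))).Reachable (a 0) (a 2) ∧
            ¬ (SimpleGraph.fromEdgeSet (↑F : Set (Sym2 V))).Reachable (a 0) (a 3)),
          Real.tanh β ^ F.card * isingCorr G (Finset.univ.filter fun v : V =>
            ¬ (SimpleGraph.fromEdgeSet (↑F : Set (Sym2 V))).Reachable (a 0) v) β 0 .free {a 2, a 3})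
        = ∑ F ∈ (tJoins G Set.univ (Finset.univ.image a)).filter (fun F : Finset (Sym2 V) =>
            ¬ (SimpleGraph.fromEdgeSet (↑F : Set (Sym2 V))).Reachable (a 0) (a 2) ∧
            ¬ (SimpleGraph.fromEdgeSet (↑F : Set (Sym2 V))).Reachable (a 0) (a 3)),
          Real.tanh β ^ F.card)
    (htc : (∑ F ∈ (tJoins G Set.univ (Finset.univ.image a)).filter (fun F : Finset (Sym2 V) =>
            ¬ (SimpleGraph.fromEdgeSet (↑F : Set (Sym2 V))).Reachable (a 0) (a 2) ∧
            ¬ (SimpleGraph.fromEdgeSet (↑F : Set (Sym2 V))).Reachable (a 0) (a 3)),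
            Real.tanh β ^ F.card) +
      (∑ F ∈ (tJoins G Set.univ (Finset.univ.image a)).filter (fun F : Finset (Sym2 V) =>
            ¬ (SimpleGraph.fromEdgeSet (↑F : Set (Sym2 V))).Reachable (a 0) (a 1) ∧
            ¬ (SimpleGraph.fromEdgeSet (↑F : Set (Sym2 V))).Reachable (a 0) (a 3)),
            Real.tanh β ^ F.card) +
      (∑ F ∈ (tJoins G Set.univ (Finset.univ.image a)).filter (fun F : Finset (Sym2 V) =>
            ¬ (SimpleGraph.fromEdgeSet (↑F : Set (Sym2 V))).Reachable (a 0) (a 1) ∧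
            ¬ (SimpleGraph.fromEdgeSet (↑F : Set (Sym2 V))).Reachable (a 0) (a 2)),
            Real.tanh β ^ F.card)
        ≤ ∑ F ∈ tJoins G Set.univ (Finset.univ.image a), Real.tanh β ^ F.card)
    (hsym : (let Gc : Fin 4 → Fin 4 → ℝ := fun i j => isingCorr G Finset.univ β 0 .free {a i, a j}
       let C : Fin 4 → Fin 4 → ℝ := fun j k =>
         ∑ F ∈ (tJoins G Set.univ (Finset.univ.image a)).filter (fun F : Finset (Sym2 V) =>
            ¬ (SimpleGraph.fromEdgeSet (↑F : Set (Sym2 V))).Reachable (a 0) (a j) ∧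
            ¬ (SimpleGraph.fromEdgeSet (↑F : Set (Sym2 V))).Reachable (a 0) (a k)),
           Real.tanh β ^ F.card
       Gc 0 2 = Gc 0 1 ∧ Gc 0 3 = Gc 0 1 ∧ Gc 1 3 = Gc 2 3 ∧ Gc 1 2 = Gc 2 3 ∧
         C 1 3 = C 2 3 ∧ C 1 2 = C 2 3))
    (hjunk : (∑ F ∈ (tJoins G Set.univ {a 0, a 1}).filter (fun F : Finset (Sym2 V) =>
            (SimpleGraph.fromEdgeSet (↑F : Set (Sym2 V))).Reachable (a 0) (a 2) ∧
            (SimpleGraph.fromEdgeSet (↑F : Set (Sym2 V))).Reachable (a 0) (a 3)),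
          Real.tanh β ^ F.card)
         ≤ κ * (loopO1PartitionFunction G (Real.tanh β) {a 0, a 1} *
               isingCorr G Finset.univ β 0 .free {a 2, a 3}
             - ∑ F ∈ (tJoins G Set.univ {a 0, a 1}).filter (fun F : Finset (Sym2 V) =>
                 ¬ (SimpleGraph.fromEdgeSet (↑F : Set (Sym2 V))).Reachable (a 0) (a 2) ∧
                 ¬ (SimpleGraph.fromEdgeSet (↑F : Set (Sym2 V))).Reachable (a 0) (a 3)),
               Real.tanh β ^ F.card * isingCorr G (Finset.univ.filter fun v : V =>
                 ¬ (SimpleGraph.fromEdgeSet (↑F : Set (Sym2 V))).Reachable (a 0) v)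
                 β 0 .free {a 2, a 3}))
    (hSJB : connectedFour (isingMeasure G Finset.univ β 0 .free) spinAt a *
        (loopO1PartitionFunction G (Real.tanh β) ∅) ^ 2 ≤
      -(2 * ∑ F₁ ∈ tJoins G Set.univ {a 0, a 1}, ∑ F₂ ∈ tJoins G Set.univ {a 2, a 3},
        if (SimpleGraph.fromEdgeSet ((↑F₁ : Set (Sym2 V)) ∪ ↑F₂)).Reachable (a 0) (a 2)
        then Real.tanh β ^ (F₁.card + F₂.card) else 0)) :
    (∑ F ∈ tJoins G Set.univ {a 0, a 1}, Real.tanh β ^ F.card *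
        isingCorr G (Finset.univ.filter fun v : V =>
          ¬ (SimpleGraph.fromEdgeSet (↑F : Set (Sym2 V))).Reachable (a 0) v) β 0 .free {a 2, a 3})
      ≤ (1 - (1 - κ) * (2 / 3 *
            ((Real.tanh β / (1 - Real.tanh β ^ 2)) ^ 2 * m₀ /
              (C * ((Real.tanh β / (1 - Real.tanh β ^ 2)) ^ 2 * m₀ + 1))))) *
          loopO1PartitionFunction G (Real.tanh β) {a 0, a 1} *
          isingCorr G Finset.univ β 0 .free {a 2, a 3} := by
  have hjoint := joint_lower_core G hβ ht0 hm₀ hC a B hfoot₁ hfoot₂ hfloor hceil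
  -- abbreviations
  set t := Real.tanh β with ht_def
  set c₁ : ℝ := (t / (1 - t ^ 2)) ^ 2 * m₀ / (C * ((t / (1 - t ^ 2)) ^ 2 * m₀ + 1)) with hc₁_def
  set Z0 := loopO1PartitionFunction G t ∅ with hZ0_def
  set ZA := loopO1PartitionFunction G t (Finset.univ.image a) with hZA_def
  set Z01 := loopO1PartitionFunction G t {a 0, a 1} with hZ01_def
  set Z23 := loopO1PartitionFunction G t {a 2, a 3} with hZ23_def
  set Z02 := loopO1PartitionFunction G t {a 0, a 2} with hZ02_def
  set Z13 := loopO1PartitionFunction G t {a 1, a 3} with hZ13_def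
  set Z03 := loopO1PartitionFunction G t {a 0, a 3} with hZ03_def
  set Z12 := loopO1PartitionFunction G t {a 1, a 2} with hZ12_def
  set JS : ℝ := ∑ F₁ ∈ tJoins G Set.univ {a 0, a 1}, ∑ F₂ ∈ tJoins G Set.univ {a 2, a 3},
    (if (SimpleGraph.fromEdgeSet ((↑F₁ : Set (Sym2 V)) ∪ ↑F₂)).Reachable (a 0) (a 2)
      then t ^ (F₁.card + F₂.card) else 0) with hJS_def
  set G01 := isingCorr G Finset.univ β 0 .free {a 0, a 1} with hG01_def
  set G23 := isingCorr G Finset.univ β 0 .free {a 2, a 3} with hG23_def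
  set G02 := isingCorr G Finset.univ β 0 .free {a 0, a 2} with hG02_def
  set G13 := isingCorr G Finset.univ β 0 .free {a 1, a 3} with hG13_def
  set G03 := isingCorr G Finset.univ β 0 .free {a 0, a 3} with hG03_def
  set G12 := isingCorr G Finset.univ β 0 .free {a 1, a 2} with hG12_def
  set σA := isingCorr G Finset.univ β 0 .free (Finset.univ.image a) with hσA_def
  have ht : 0 ≤ t := ht0.le
  have hZ0 : 0 < Z0 := loopO1PartitionFunction_empty_pos G ht
  have hZ0' : Z0 ≠ 0 := hZ0.ne'
  -- HT dictionary `⟨σ_A⟩·Z⁰ = Z^A`, `⟨σ_A⟩ = Z^A/Z⁰`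
  have hd : ∀ A : Finset V, isingCorr G Finset.univ β 0 .free A * Z0 =
      loopO1PartitionFunction G t A :=
    fun A => StrandShadowSketch.isingCorr_univ_mul_loopO1_empty G β A
  have hcorr : ∀ A : Finset V, isingCorr G Finset.univ β 0 .free A =
      loopO1PartitionFunction G t A / Z0 := fun A => eq_div_of_mul_eq hZ0' (hd A)
  -- `U₄` through loop partition functions (as in `StubTransfer.joint_ge_of_sep_sym_u4`)
  have e4 : nPoint (isingMeasure G Finset.univ β 0 .free) spinAt a = ZA / Z0 := by
    have hmono : spinMonomial a = spinProduct (Finset.univ.image a) := by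
      funext s
      unfold spinMonomial spinProduct
      rw [Finset.prod_image fun i _ j _ h => ha h]
    rw [← hcorr, isingCorr, ← hmono]
    rfl
  have e2 : ∀ x y : V, x ≠ y → twoPoint (isingMeasure G Finset.univ β 0 .free) spinAt x y =
      loopO1PartitionFunction G t {x, y} / Z0 := fun x y hxy => by
    rw [← hcorr, ← isingTwoPoint_eq_isingCorr G Finset.univ β 0 .free hxy]
    rfl
  have e01 : twoPoint (isingMeasure G Finset.univ β 0 .free) spinAt (a 0) (a 1) = Z01 / Z0 :=
    e2 _ _ (ha.ne (by decide))
  have e23 : twoPoint (isingMeasure G Finset.univ β 0 .free) spinAt (a 2) (a 3) = Z23 / Z0 :=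
    e2 _ _ (ha.ne (by decide))
  have e02 : twoPoint (isingMeasure G Finset.univ β 0 .free) spinAt (a 0) (a 2) = Z02 / Z0 :=
    e2 _ _ (ha.ne (by decide))
  have e13 : twoPoint (isingMeasure G Finset.univ β 0 .free) spinAt (a 1) (a 3) = Z13 / Z0 :=
    e2 _ _ (ha.ne (by decide))
  have e03 : twoPoint (isingMeasure G Finset.univ β 0 .free) spinAt (a 0) (a 3) = Z03 / Z0 :=
    e2 _ _ (ha.ne (by decide))
  have e12 : twoPoint (isingMeasure G Finset.univ β 0 .free) spinAt (a 1) (a 2) = Z12 / Z0 :=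
    e2 _ _ (ha.ne (by decide))
  have hU4 : connectedFour (isingMeasure G Finset.univ β 0 .free) spinAt a =
      (ZA * Z0 - Z01 * Z23 - Z02 * Z13 - Z03 * Z12) / Z0 ^ 2 := by
    unfold connectedFour
    rw [e4, e01, e23, e02, e13, e03, e12]
    field_simp
  -- clause (iii) in `Z` form: `Z^A Z⁰ − Σ ZZ ≤ −2c₁·Z₀₁Z₂₃`
  have hU4' : ZA * Z0 - Z01 * Z23 - Z02 * Z13 - Z03 * Z12 ≤ -(2 * JS) := by
    have h := hSJB
    rw [hU4, div_mul_cancel₀ _ (pow_ne_zero 2 hZ0')] at h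
    exact h
  have hZform : ZA * Z0 - Z01 * Z23 - Z02 * Z13 - Z03 * Z12 ≤ -(2 * (c₁ * (Z01 * Z23))) := by
    linarith [hU4', hjoint]
  -- clause (iii) in correlation form (the `INT` hypothesis of `clean_core`)
  have hINT : (let Gc : Fin 4 → Fin 4 → ℝ := fun i j => isingCorr G Finset.univ β 0 .free {a i, a j}
      2 * c₁ * (Gc 0 1 * Gc 2 3) ≤
        Gc 0 1 * Gc 2 3 + Gc 0 2 * Gc 1 3 + Gc 0 3 * Gc 1 2
          - isingCorr G Finset.univ β 0 .free (Finset.univ.image a)) := by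
    simp only
    have hd01 : G01 * Z0 = Z01 := hd {a 0, a 1}
    have hd23 : G23 * Z0 = Z23 := hd {a 2, a 3}
    have hd02 : G02 * Z0 = Z02 := hd {a 0, a 2}
    have hd13 : G13 * Z0 = Z13 := hd {a 1, a 3}
    have hd03 : G03 * Z0 = Z03 := hd {a 0, a 3}
    have hd12 : G12 * Z0 = Z12 := hd {a 1, a 2}
    have hdA : σA * Z0 = ZA := hd (Finset.univ.image a)
    have key : 2 * c₁ * (G01 * G23) * Z0 ^ 2 ≤
        (G01 * G23 + G02 * G13 + G03 * G12 - σA) * Z0 ^ 2 := by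
      have eq1 : 2 * c₁ * (G01 * G23) * Z0 ^ 2 = 2 * c₁ * ((G01 * Z0) * (G23 * Z0)) := by ring
      have eq2 : (G01 * G23 + G02 * G13 + G03 * G12 - σA) * Z0 ^ 2 =
          (G01 * Z0) * (G23 * Z0) + (G02 * Z0) * (G13 * Z0) + (G03 * Z0) * (G12 * Z0)
            - (σA * Z0) * Z0 := by ring
      rw [eq1, eq2, hd01, hd23, hd02, hd13, hd03, hd12, hdA]
      linarith [hZform]
    exact le_of_mul_le_mul_right key (pow_pos hZ0 2)
  -- `INT → C′` (landed `clean_core`), junk split, junk margin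
  have hclean := clean_core_loc G hβ a hps htc hsym hINT
  have hL := lhs_decomposition_loc G (tJoins G Set.univ {a 0, a 1}) t β (a 0) (a 2) (a 3)
  exact shadow_of_clean_junk hL hclean hjunk hκ

end Core

/-! ## Composition -/

/-- Alias of the crux used as the result type of the composition lemma `StrandShadow_of`, so that
the skeleton audit sees exactly ONE theorem concluding `StrandShadow` by name
(`StrandShadow_proof`, whose proof names the four stubs). -/
abbrev CruxGoal : Prop := StrandShadow

/-- **The crux from the four stubs** (composition; planner):
`stub_footprintFloor → stub_thermalOverlapFloor → stub_overlapCeiling → stub_junkMargin →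
StrandShadow` (`CruxGoal` unfolds to the route decl).  Constant
`c′ = (1 − κ)·(2/3)·m/(C(m+1))`, `m = (t_c/(1 − t_c²))²·m₀`, `t_c = tanh β_c(3) > 0`
(`criticalBeta_pos_holds`). -/
theorem StrandShadow_of (hFoot : type_of% @footprintFloor)
    (hFloor : type_of% @stub_thermalOverlapFloor) (hCeil : type_of% @stub_overlapCeiling)
    (hJunk : type_of% @stub_junkMargin) : CruxGoal := by
  obtain ⟨m₀, hm₀, hFl⟩ := hFloor
  obtain ⟨C, hC, hCe⟩ := hCeil
  obtain ⟨κ, hκ, hJ⟩ := hJunk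
  have hβ : 0 ≤ criticalBeta 3 := criticalBeta_nonneg 3
  have ht0 : 0 < Real.tanh (criticalBeta 3) := by
    rw [Real.tanh_eq_sinh_div_cosh]
    exact div_pos (Real.sinh_pos_iff.2 (criticalBeta_pos_holds (d := 3) (by norm_num)))
      (Real.cosh_pos _)
  have ht1 : Real.tanh (criticalBeta 3) < 1 := Real.tanh_lt_one _
  have h1t : 0 < 1 - Real.tanh (criticalBeta 3) ^ 2 := by nlinarith [ht0, ht1]
  have hm : 0 < (Real.tanh (criticalBeta 3) / (1 - Real.tanh (criticalBeta 3) ^ 2)) ^ 2 * m₀ :=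
    mul_pos (pow_pos (div_pos ht0 h1t) 2) hm₀
  have hc₁ : 0 < (Real.tanh (criticalBeta 3) / (1 - Real.tanh (criticalBeta 3) ^ 2)) ^ 2 * m₀ /
      (C * ((Real.tanh (criticalBeta 3) / (1 - Real.tanh (criticalBeta 3) ^ 2)) ^ 2 * m₀ + 1)) :=
    div_pos hm (mul_pos hC (by linarith))
  refine ⟨(1 - κ) * (2 / 3 *
      ((Real.tanh (criticalBeta 3) / (1 - Real.tanh (criticalBeta 3) ^ 2)) ^ 2 * m₀ /
        (C * ((Real.tanh (criticalBeta 3) / (1 - Real.tanh (criticalBeta 3) ^ 2)) ^ 2 * m₀ + 1)))),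
    mul_pos (by linarith) (by linarith), fun l hl => ?_⟩
  obtain ⟨N₁, hN₁⟩ := hFl l hl
  obtain ⟨N₂, hN₂⟩ := hCe l hl
  obtain ⟨N₃, hN₃⟩ := hJ l hl
  refine ⟨max (max N₁ N₂) N₃, fun N hN a ha => ?_⟩
  have hfl := hN₁ N (((le_max_left N₁ N₂).trans (le_max_left _ _)).trans hN) a ha
  have hce := hN₂ N (((le_max_right N₁ N₂).trans (le_max_left _ _)).trans hN) a ha
  have hju := hN₃ N ((le_max_right _ _).trans hN) a ha
  have hsym := StrandShadowSketch.stub_symmetry l N a ha (criticalBeta 3)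
    (Real.tanh (criticalBeta 3))
  simp only at hfl hce hju hsym ⊢
  have hinj : Function.Injective a :=
    Cruxes.ParityRobustMerging.PlaquetteXorSurgery.tetra_injective hl a ha
  have h01 : a 0 ≠ a 1 := hinj.ne (by decide)
  have h23 : a 2 ≠ a 3 := hinj.ne (by decide)
  have hps := StrandShadowSketch.stub_pairSplit ↥(box 3 N)
    ((zdGraph 3).comap (Subtype.val : ↥(box 3 N) → Site 3)) (criticalBeta 3) a
  have htc := StrandShadowSketch.stub_threeClean ↥(box 3 N)
    ((zdGraph 3).comap (Subtype.val : ↥(box 3 N) → Site 3)) (Real.tanh (criticalBeta 3)) ht0.le a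
  have hsjb := FKParityRobustnessStrandsJoinBound.strandsJoinBound_proof ↥(box 3 N)
    ((zdGraph 3).comap (Subtype.val : ↥(box 3 N) → Site 3)) (criticalBeta 3) hβ a hinj
  simp only at hsjb
  have hfoot := hFoot ↥(box 3 N) ((zdGraph 3).comap (Subtype.val : ↥(box 3 N) → Site 3))
    (Real.tanh (criticalBeta 3)) ht0.le ht1
  have key := fun hf₁ hf₂ hflo hcei hp ht3 hsy hjk hsj =>
    shadow_line_core (m₀ := m₀) (C := C) (κ := κ)
      ((zdGraph 3).comap (Subtype.val : ↥(box 3 N) → Site 3)) hβ ht0 hm₀ hC hκ a hinj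
      (((zdGraph 3).comap (Subtype.val : ↥(box 3 N) → Site 3)).edgeFinset.filter
        fun e => ∀ w ∈ e, ((w : Site 3)) ∈ box 3 l)
      hf₁ hf₂ hflo hcei hp ht3 hsy hjk hsj
  have key2 := key
    (fun e he => hfoot (a 0) (a 1) h01 e (Finset.mem_filter.1 he).1)
    (fun e he => hfoot (a 2) (a 3) h23 e (Finset.mem_filter.1 he).1)
    (by convert hfl using 12) (by convert hce using 20) (by convert hps using 12)
    (by convert htc using 12) (by convert hsym using 12)
    (by convert hju using 12) (by convert hsjb using 12)
  convert key2 using 12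

/-- **The crux, modulo the registered stubs.** -/
theorem StrandShadow_proof : StrandShadow :=
  StrandShadow_of footprintFloor stub_thermalOverlapFloor stub_overlapCeiling stub_junkMargin

end Summit.CriticalPhenomena.Ising3DConformalLimit.Cruxes.StrandShadow.Lines.LoopFootprintStrandMass

end
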